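import Summits.Ventures.HSemireg.WeilFrameRealCarrierDegrees
import Summits.Ventures.HSemireg.Mod4LeadingTermMiddle
import Summits.Ventures.HSemireg.Mod4PureMiddleSpectrum

/-!
# Venture HSemireg — TABLE R's PURE MIDDLE ROW `x = (q_n/n!) ĥⁿ + ĉ₊ + ĉ₋` ON THE REAL CARRIER AT EVERY PIN, every `n`:
# at `t = (−1)ⁿ C(n,a)² q_n²` (`a ≤ n`): `dim S_n(x) + 2(n+1) + (1 if 2a = n, else 2) = (n+3)·C(2n,n)`

HONEST FRAMING. Part of the Lean index of the computation cell `pub-hsemireg` (seat w3-mod4-1 gen 14, W3 SPECIAL FIBRES;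
MOD4-OFFSPLIT §8 TABLE R row «pure middle q_n η_n + w»: middle entries `24 → 22` (`n = 2`), `112 → 110` (`n = 3`) computed ×2
(codes A = B), `480 → 478` (`n = 4`, kit j179422) ×1 on the one locus `(w,w)_χ = 2Dq_n²` found by the scan; §13.23 NET «ON the pin
set the drop (1 or 2) … is NOT treated»). The tree's real carriers and the Literature's Weil-type layer ONLY: no semiregularity
map, no Ext group, no `∫`; nothing here says that HC / HC_CM / HC_AV holds; nothing here is a claim about any explicit variety or
cycle; no Literature fact is declared; NO definition is introduced. Imports: FILE 13 `WeilFrameRealCarrierDegrees` (built) + the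
pure matrix files `Mod4LeadingTermMiddle` (rank of the middle Hankel matrix) and `Mod4PureMiddleSpectrum` (the diagonal `M_f`).

WHAT IS PROVED, for `A : AbelianVariety ℂ` of dimension `2n` (`n ≥ 1`), `φ ≫ φ = -(d • 𝟙 A)`, `d ≥ 1`, `P, Q` the
`±i√d`-eigenspaces, `dim (P ⊓ H^{1,0}) = n`, `h` `K`-symmetric of type `(1,1)` with `ĥ^{2n} ≠ 0`, non-zero `c± ∈ E±`, the class
`x = Σ_{m ≤ 2n} (q_m/m!) ĥ^m + ĉ₊ + ĉ₋` with `q_m = 0` for ALL `m ≠ n` and `q_n ≠ 0` (h-part `(q_n/n!) ĥⁿ` alone), and the pin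
`(2n)!·(ĉ₊ĉ₋) = t·ĥ^{2n}`:
* **`finrank_S_pureMiddle_pin`** — at `t = (−1)ⁿ C(n,a)² q_n²`, `a ≤ n`:
  `dim S_n(x) + 2(n+1) + (if 2a = n then 1 else 2) = (n+3)·C(2n,n)` (`r_n = n + 1` by `Mod4.hankel1_rank_leading_middle`,
  `dim ker(M_f − t) = 1 ∕ 2` by `Mod4.finrank_ker_middleM_pure`, in FILE 13's `finrank_S_weilType_middle`);
* **`finrank_S_pureMiddle_generic`** — off the pins (`t ≠ (−1)ⁿ C(n,a)² q_n²` for all `a ≤ n`): `dim S_n(x) + 2(n+1) = (n+3)·C(2n,n)`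
  (the special case `q_{>n} = 0` of `WeilFrameLeadingTermMiddle`, restated here so that the pure row is complete in one file).
THE PURE ROW's MIDDLE ENTRY, every pin: `n = 2`: `22` at `t = q₂²`, `23` at `t = 4q₂²`, else `24`; `n = 3`: `110` at `t = −q₃²` and at
`t = −9q₃²`, else `112`; `n = 4`: `478` at `t = q₄²` and at `t = 16q₄²`, `479` at `t = 36q₄²`, else `480` (§8 printed the first pin of
each `n` only; the others are this file's statement, registered on the cell bus before any machine run). Everything PROVED, 0 sorry.
References: [BuchweitzFlenner2008HH] Prop. 6.4.4; [vanGeemen1994HodgeAV] 4.9, Lemma 5.2; [BourbakiAlgebre1a3] Ch. III §8, §11 no. 9.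
-/

noncomputable section

open CliffordAlgebra (contractLeft)
open ExteriorAlgebra (ι)
open Module CategoryTheory
open Literature.AlgebraicGeometry.Motives Literature.AlgebraicGeometry.HodgeTheory
open Literature.AlgebraicTopology.SingularHomology

namespace Summit.Ventures.HSemireg.WeilFrame

open Summit.Ventures.HSemireg.WedgeBridge Summit.Ventures.HSemireg.WeilCarrier Summit.Ventures.HSemireg.Mod4Carrier
open Summit.Ventures.HSemireg.Wedge.Hankel

section RealCarrier

variable {A : AbelianVariety ℂ}

/-- **TABLE R's pure middle row AT A PIN on the real carrier** (`n ≥ 1`): for `q_m = 0` (`m ≠ n`), `q_n ≠ 0`, `a ≤ n` and the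
pin `t = (−1)ⁿ C(n,a)² q_n²`: `dim S_n(x) + 2(n+1) + (1 if 2a = n, else 2) = (n+3)·C(2n,n)`.
[cite: BuchweitzFlenner2008HH, Prop. 6.4.4] [cite: vanGeemen1994HodgeAV, 4.9 and Lemma 5.2] -/
theorem finrank_S_pureMiddle_pin (hA : IsSmoothProjective A.dim A.X) {n d : ℕ} (hdim : A.dim = n + n) (hd : 0 < d)
    {φ : A ⟶ A} (hφ : φ ≫ φ = -(d • 𝟙 A)) {P Q : Submodule ℂ (complexBetti A.X 1)}
    (hP : P = Module.End.eigenspace (complexBetti.map φ.hom.hom.hom 1).hom (Complex.I * (Real.sqrt d : ℂ)))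
    (hQ : Q = Module.End.eigenspace (complexBetti.map φ.hom.hom.hom 1).hom (-(Complex.I * (Real.sqrt d : ℂ))))
    (hp : finrank ℂ ↥(P ⊓ hodgeOneZero hA) = n) {h : complexBetti A.X 2}
    (hh : complexBetti.map φ.hom.hom.hom 2 h = (d : ℂ) • h) (h11 : IsOfHodgeType A.dim A.X 2 1 1 h)
    (hvol : ((⋀[ℂ]^2 (complexBetti A.X 1)).subtype ((abelianVarietyCohomologyExteriorH1_holds.equiv A 2).symm h)) ^ (n + n) ≠ 0)
    {cP cQ : complexBetti A.X (2 * n)} (hcP : cP ∈ weilClassesPlus A φ n d) (hcP0 : cP ≠ 0)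
    (hcQ : cQ ∈ weilClassesMinus A φ n d) (hcQ0 : cQ ≠ 0) (hn : 1 ≤ n)
    {q : ℕ → ℂ} (hq : ∀ m, m ≠ n → q m = 0) (hqn : q n ≠ 0) {t : ℂ}
    (ht : (((n + n).factorial : ℕ) : ℂ) •
        ((⋀[ℂ]^(2 * n) (complexBetti A.X 1)).subtype ((abelianVarietyCohomologyExteriorH1_holds.equiv A (2 * n)).symm cP) *
          (⋀[ℂ]^(2 * n) (complexBetti A.X 1)).subtype ((abelianVarietyCohomologyExteriorH1_holds.equiv A (2 * n)).symm cQ)) =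
      t • ((⋀[ℂ]^2 (complexBetti A.X 1)).subtype ((abelianVarietyCohomologyExteriorH1_holds.equiv A 2).symm h)) ^ (n + n))
    {a : ℕ} (ha : a ≤ n) (hpin : t = (-1 : ℂ) ^ n * ((n.choose a : ℂ) * (n.choose a : ℂ)) * (q n * q n)) :
    finrank ℂ ↥(S ℂ (hodgeZeroOne hA) n
        ((∑ m ∈ Finset.range (n + n + 1), (q m * ((m.factorial : ℕ) : ℂ)⁻¹) •
            ((⋀[ℂ]^2 (complexBetti A.X 1)).subtype ((abelianVarietyCohomologyExteriorH1_holds.equiv A 2).symm h)) ^ m) +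
          (⋀[ℂ]^(2 * n) (complexBetti A.X 1)).subtype ((abelianVarietyCohomologyExteriorH1_holds.equiv A (2 * n)).symm cP) +
          (⋀[ℂ]^(2 * n) (complexBetti A.X 1)).subtype ((abelianVarietyCohomologyExteriorH1_holds.equiv A (2 * n)).symm cQ))) +
        2 * (n + 1) + (if 2 * a = n then 1 else 2) = (n + 3) * (n + n).choose n := by
  haveI : Module.Finite ℂ (complexBetti A.X 1) := abelianVarietyCohomologyExteriorH1_holds.finite_one A
  have hq0 : ∀ m, m < n → q m = 0 := fun m hm => hq m (by omega)
  have h := finrank_S_weilType_middle hA hdim hd hφ hP hQ hp hh h11 hvol hcP hcP0 hcQ hcQ0 hn q ht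
  rw [Mod4.hankel1_rank_leading_middle hq0 hqn, Mod4.finrank_ker_middleM_pure hq hqn ha hpin] at h
  have e : (n + 1 + 2) * (n + n).choose n = (n + 3) * (n + n).choose n := by ring
  omega

/-- **TABLE R's pure middle row OFF THE PINS on the real carrier** (`n ≥ 1`): for `q_m = 0` (`m ≠ n`), `q_n ≠ 0` and
`t ≠ (−1)ⁿ C(n,a)² q_n²` for every `a ≤ n`: `dim S_n(x) + 2(n+1) = (n+3)·C(2n,n)` (special case of the `ch(O_Z)`-shape theorem).
[cite: BuchweitzFlenner2008HH, Prop. 6.4.4] [cite: vanGeemen1994HodgeAV, 4.9 and Lemma 5.2] -/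
theorem finrank_S_pureMiddle_generic (hA : IsSmoothProjective A.dim A.X) {n d : ℕ} (hdim : A.dim = n + n) (hd : 0 < d)
    {φ : A ⟶ A} (hφ : φ ≫ φ = -(d • 𝟙 A)) {P Q : Submodule ℂ (complexBetti A.X 1)}
    (hP : P = Module.End.eigenspace (complexBetti.map φ.hom.hom.hom 1).hom (Complex.I * (Real.sqrt d : ℂ)))
    (hQ : Q = Module.End.eigenspace (complexBetti.map φ.hom.hom.hom 1).hom (-(Complex.I * (Real.sqrt d : ℂ))))
    (hp : finrank ℂ ↥(P ⊓ hodgeOneZero hA) = n) {h : complexBetti A.X 2}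
    (hh : complexBetti.map φ.hom.hom.hom 2 h = (d : ℂ) • h) (h11 : IsOfHodgeType A.dim A.X 2 1 1 h)
    (hvol : ((⋀[ℂ]^2 (complexBetti A.X 1)).subtype ((abelianVarietyCohomologyExteriorH1_holds.equiv A 2).symm h)) ^ (n + n) ≠ 0)
    {cP cQ : complexBetti A.X (2 * n)} (hcP : cP ∈ weilClassesPlus A φ n d) (hcP0 : cP ≠ 0)
    (hcQ : cQ ∈ weilClassesMinus A φ n d) (hcQ0 : cQ ≠ 0) (hn : 1 ≤ n)
    {q : ℕ → ℂ} (hq : ∀ m, m ≠ n → q m = 0) (hqn : q n ≠ 0) {t : ℂ}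
    (ht : (((n + n).factorial : ℕ) : ℂ) •
        ((⋀[ℂ]^(2 * n) (complexBetti A.X 1)).subtype ((abelianVarietyCohomologyExteriorH1_holds.equiv A (2 * n)).symm cP) *
          (⋀[ℂ]^(2 * n) (complexBetti A.X 1)).subtype ((abelianVarietyCohomologyExteriorH1_holds.equiv A (2 * n)).symm cQ)) =
      t • ((⋀[ℂ]^2 (complexBetti A.X 1)).subtype ((abelianVarietyCohomologyExteriorH1_holds.equiv A 2).symm h)) ^ (n + n))
    (hgen : ∀ a, a ≤ n → t ≠ (-1 : ℂ) ^ n * ((n.choose a : ℂ) * (n.choose a : ℂ)) * (q n * q n)) :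
    finrank ℂ ↥(S ℂ (hodgeZeroOne hA) n
        ((∑ m ∈ Finset.range (n + n + 1), (q m * ((m.factorial : ℕ) : ℂ)⁻¹) •
            ((⋀[ℂ]^2 (complexBetti A.X 1)).subtype ((abelianVarietyCohomologyExteriorH1_holds.equiv A 2).symm h)) ^ m) +
          (⋀[ℂ]^(2 * n) (complexBetti A.X 1)).subtype ((abelianVarietyCohomologyExteriorH1_holds.equiv A (2 * n)).symm cP) +
          (⋀[ℂ]^(2 * n) (complexBetti A.X 1)).subtype ((abelianVarietyCohomologyExteriorH1_holds.equiv A (2 * n)).symm cQ))) +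
        2 * (n + 1) = (n + 3) * (n + n).choose n := by
  haveI : Module.Finite ℂ (complexBetti A.X 1) := abelianVarietyCohomologyExteriorH1_holds.finite_one A
  have hq0 : ∀ m, m < n → q m = 0 := fun m hm => hq m (by omega)
  have h := finrank_S_weilType_middle hA hdim hd hφ hP hQ hp hh h11 hvol hcP hcP0 hcQ hcQ0 hn q ht
  rw [Mod4.hankel1_rank_leading_middle hq0 hqn, Mod4.finrank_ker_middleM_leading hq0 hgen] at h
  have e : (n + 1 + 2) * (n + n).choose n = (n + 3) * (n + n).choose n := by ring
  omega

end RealCarrier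

end Summit.Ventures.HSemireg.WeilFrame

end
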